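import Summits.HubbardSuperconductivity.HubbardSuperconductivity.Theses.DeformationLadder
import Summits.HubbardSuperconductivity.HubbardSuperconductivity.Theorems.WeakCouplingBCSWcbcsBcsConstructionInteractionComparison

/-!
# Route DeformationLadder — support `EnergySandwich` (item stmt-HubbardSuperconductivity-1899)

Repulsion sandwich for the `d`-wave source energies at finite `L`: for `0 ≤ U`,
`E₀(dWaveSourceTorus L 0 μ h) ≤ E₀(dWaveSourceTorus L U μ h) ≤ E₀(dWaveSourceTorus L 0 μ h) + U L²`.

The two (Hermitian) matrices differ by `(U : ℂ) • Σ_x n_{x↑} n_{x↓}` (the chemical-potential and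
source terms cancel, `dWaveSourceTorus_sub_dWaveSourceTorus_coupling`), and
`0 ≤ Σ_x n_{x↑} n_{x↓} ≤ |Λ| = L²` as operators, so Loewner monotonicity of the ground energy of a
Hermitian matrix (the tracial ground state of one is a trial state for the other) gives both
inequalities. Both halves are already in the tree for general couplings `U ≤ U'`
(`groundEnergy_dWaveSourceTorus_mono_coupling`, `groundEnergy_dWaveSourceTorus_le_add_coupling`,
file `Theorems/WeakCouplingBCSWcbcsBcsConstructionInteractionComparison.lean`, route
WeakCouplingBCS); this file specialises them to `U' := U`, `U := 0`. Sources: Bach–Lieb–Solovej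
(1994) (positivity of the on-site repulsion); Tasaki (2020) §2.1 (variational principle);
Koma–Tasaki (1994) §1.
-/

set_option linter.dupNamespace false -- summit = problem name (single-conjunct summit), D-0017

namespace Summit.HubbardSuperconductivity.HubbardSuperconductivity.Theorems

open Literature.MathematicalPhysics.QuantumLattice

/-- **`EnergySandwich`** (route DeformationLadder, item stmt-HubbardSuperconductivity-1899): for
`0 ≤ U`, `E₀(dWaveSourceTorus L 0 μ h) ≤ E₀(dWaveSourceTorus L U μ h) ≤ E₀(dWaveSourceTorus L 0 μ h) + U L²`
— the interacting and free source ground energies differ by at most `U L²`, uniformly in `μ` and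
`h` (so the energy densities differ by at most `U`). Bach–Lieb–Solovej (1994); Tasaki (2020) §2.1;
Koma–Tasaki (1994) §1. -/
theorem energySandwich_proof :
    Summit.HubbardSuperconductivity.HubbardSuperconductivity.Theses.DeformationLadder.EnergySandwich := by
  unfold Theses.DeformationLadder.EnergySandwich
  intro L _ U μ h hU
  have h2 := groundEnergy_dWaveSourceTorus_le_add_coupling L μ h hU
  rw [sub_zero] at h2
  exact ⟨groundEnergy_dWaveSourceTorus_mono_coupling L μ h hU, h2⟩

end Summit.HubbardSuperconductivity.HubbardSuperconductivity.Theorems
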